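import Mathlib
import HarnessLib
import Summits.HubbardSuperconductivity.HubbardSuperconductivity.Theorems.KLProgrammeKLRegimeWickCrossContractionPushforward

/-!
# Route `KLProgramme` — ENGINE child gen 8 (stmt-HubbardSuperconductivity-20437 `KLRegimeEngineV17F2`), stub (c) `stub_engine_step_values`,
# (E2-v10)/E.5 lane: PUSH-FORWARD of a WEIGHTED SUM of two-vertex line terms to the physical fields
# (cell gate-hubbard-kl, seat p5 g6; sequel to `…WickCrossContractionPushforward` (p523040), companion of `…GramTailValue`)

The source of the within-slice flow (`klws_flow_source_eq`) contains `dblFold(Δ_×(Ċ)((e^{Δ_×(D)} − Δ_×(D))(W⁰W¹)))` with `W = map S(F̃) W′`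
(`map_sectorSub_sectorPreimage`) and `e^{Δ_×(D)} = Σ_i (i!)⁻¹Δ_×(D)^i` a FIXED finite sum (`gaussConv_eq_sum_range`).  `…Pushforward` moves ONE line list to
the sector fields; here the same for a weighted sum of powers behind one distinguished line, so that the consumer can feed the per-`(colouring, i)`
sector-side bounds (`…GramFamily`, summed by `…GramTailValue`) straight in:

* `crossLaplacian_pow_mul_map` — `(Δ_×(D)^i·Δ_×(g)) ∘ map(M ⊗ₖ 1) = map(M ⊗ₖ 1) ∘ (Δ_×(MᵀDM)^i·Δ_×(MᵀgM))`;
* **`dblFold_crossLaplacian_mul_pow_map`** — `dblFold(Δ_×(g)(Δ_×(D)^i((map M a′)⁰(map M b′)¹))) = map M (dblFold((Δ_×(MᵀDM)^i·Δ_×(MᵀgM))(a′⁰b′¹)))`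
  (the distinguished line applied last on the left, listed FIRST on the right — the line-`0` convention of the bridge; cross Laplacians commute);
* **`norm_kernel_dblFold_crossLaplacian_sum_pow_map_le`** — for any finite `S ⊂ ℕ` and weights `c : ℕ → ℂ`:
  `‖kernel(dblFold(Δ_×(g)((Σ_{i∈S} c_i • Δ_×(D)^i)((map M a′)⁰(map M b′)¹)))) m X′‖ ≤ R^m · Σ_s Σ_{i∈S} ‖c_i‖·B s i`, given the row sums of `‖M‖`
  are `≤ R` and per-`(s, i)` bounds `B s i` of the SECTOR-FIELD kernels of `(Δ_×(MᵀDM)^i·Δ_×(MᵀgM))(a′⁰b′¹)` at colouring `s`, uniformly in the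
  labelled tuple (exactly the left sides of `…GramTailValue` at `k = i + 1` via its `listProd_ite_zero_eq_pow_mul`, or of `…GramValue` for the small `i`).

Pure algebra / triangle inequality; no definitions, no named facts, nothing about the model.
-/

noncomputable section

namespace Summit.HubbardSuperconductivity.HubbardSuperconductivity.Theorems.KLRegimeWick

set_option linter.dupNamespace false -- summit = problem name (single-conjunct summit), D-0017

open Literature.MathematicalPhysics.QuantumLattice GrassmannAlgebra Finset Matrix
open scoped Kronecker

/-! ## §1 Transport of `Δ_×(D)^i·Δ_×(g)` -/

section Transport

variable (R : Type*) [CommRing R] [Algebra ℚ R] {Γ Γ' : Type*} [Fintype Γ] [DecidableEq Γ] [Fintype Γ'] [DecidableEq Γ']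

/-- `(Δ_×(D)^i·Δ_×(g))(map (M ⊗ₖ 1) y) = map (M ⊗ₖ 1) ((Δ_×(MᵀDM)^i·Δ_×(MᵀgM)) y)`. [folklore] -/
theorem crossLaplacian_pow_mul_map (i : ℕ) (M : Matrix Γ' Γ R) (g D : Matrix Γ' Γ' R) (y : GrassmannAlgebra R (Γ × Fin 2)) :
    (grassmannLaplacian R (crossCov R D) ^ i * grassmannLaplacian R (crossCov R g))
        (ExteriorAlgebra.map (Matrix.toLin' (M ⊗ₖ (1 : Matrix (Fin 2) (Fin 2) R))) y) =
      ExteriorAlgebra.map (Matrix.toLin' (M ⊗ₖ (1 : Matrix (Fin 2) (Fin 2) R)))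
        ((grassmannLaplacian R (crossCov R (M.transpose * D * M)) ^ i * grassmannLaplacian R (crossCov R (M.transpose * g * M))) y) := by
  have hD := listProd_crossLaplacian_map R M (fun _ : Fin i => D) (grassmannLaplacian R (crossCov R (M.transpose * g * M)) y)
  rw [List.ofFn_const, List.ofFn_const, List.reverse_replicate, List.reverse_replicate, List.prod_replicate, List.prod_replicate] at hD
  rw [Module.End.mul_apply, Module.End.mul_apply, grassmannLaplacian_crossCov_map, hD]

/-- **Transport of one term of the source**: `dblFold(Δ_×(g)(Δ_×(D)^i((map M a′)⁰·(map M b′)¹))) =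
map M (dblFold((Δ_×(MᵀDM)^i·Δ_×(MᵀgM))(a′⁰·b′¹)))`. [folklore] -/
theorem dblFold_crossLaplacian_mul_pow_map (i : ℕ) (M : Matrix Γ' Γ R) (g D : Matrix Γ' Γ' R) (a' b' : GrassmannAlgebra R Γ) :
    dblFold R (grassmannLaplacian R (crossCov R g) ((grassmannLaplacian R (crossCov R D) ^ i)
        (dblCopy R 0 (ExteriorAlgebra.map (Matrix.toLin' M) a') * dblCopy R 1 (ExteriorAlgebra.map (Matrix.toLin' M) b')))) =
      ExteriorAlgebra.map (Matrix.toLin' M) (dblFold R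
        ((grassmannLaplacian R (crossCov R (M.transpose * D * M)) ^ i * grassmannLaplacian R (crossCov R (M.transpose * g * M)))
          (dblCopy R 0 a' * dblCopy R 1 b'))) := by
  have hc : grassmannLaplacian R (crossCov R g) ((grassmannLaplacian R (crossCov R D) ^ i)
      (dblCopy R 0 (ExteriorAlgebra.map (Matrix.toLin' M) a') * dblCopy R 1 (ExteriorAlgebra.map (Matrix.toLin' M) b'))) =
      (grassmannLaplacian R (crossCov R D) ^ i * grassmannLaplacian R (crossCov R g))
        (dblCopy R 0 (ExteriorAlgebra.map (Matrix.toLin' M) a') * dblCopy R 1 (ExteriorAlgebra.map (Matrix.toLin' M) b')) := by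
    rw [← Module.End.mul_apply, ((commute_grassmannLaplacian R (crossCov R g) (crossCov R D)).pow_right i).eq]
  rw [hc, ← map_kronecker_dblCopy, ← map_kronecker_dblCopy, ← map_mul, crossLaplacian_pow_mul_map, dblFold_map_kronecker]

end Transport

/-! ## §2 The weighted sum of terms, pushed forward and bounded -/

section Bound

variable {Γ Γ' : Type*} [Fintype Γ] [DecidableEq Γ] [Fintype Γ'] [DecidableEq Γ']

/-- **Push-forward of a weighted sum of two-vertex line terms**: with the row sums of `‖M‖` at most `R` and per-`(colouring, i)` bounds `B s i ≥ 0`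
of the sector-field kernels of `(Δ_×(MᵀDM)^i·Δ_×(MᵀgM))(a′⁰·b′¹)` (uniform in the labelled tuple),
`‖kernel(dblFold(Δ_×(g)((Σ_{i∈S} c_i • Δ_×(D)^i)((map M a′)⁰·(map M b′)¹)))) m X′‖ ≤ R^m · Σ_s Σ_{i∈S} ‖c_i‖·B s i`. [folklore] -/
theorem norm_kernel_dblFold_crossLaplacian_sum_pow_map_le {m : ℕ} (M : Matrix Γ' Γ ℂ) (g D : Matrix Γ' Γ' ℂ) (S : Finset ℕ) (c : ℕ → ℂ)
    (a' b' : GrassmannAlgebra ℂ Γ) (X' : Fin m → Γ') {R : ℝ} (hrow : ∀ a, ∑ b, ‖M a b‖ ≤ R)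
    (B : (Fin m → Fin 2) → ℕ → ℝ) (hB0 : ∀ s i, 0 ≤ B s i)
    (hB : ∀ i ∈ S, ∀ (s : Fin m → Fin 2) (X : Fin m → Γ),
      ‖kernel ℂ ((grassmannLaplacian ℂ (crossCov ℂ (M.transpose * D * M)) ^ i * grassmannLaplacian ℂ (crossCov ℂ (M.transpose * g * M)))
        (dblCopy ℂ 0 a' * dblCopy ℂ 1 b')) m (fun j => (X j, s j))‖ ≤ B s i) :
    ‖kernel ℂ (dblFold ℂ (grassmannLaplacian ℂ (crossCov ℂ g)
        ((∑ i ∈ S, c i • grassmannLaplacian ℂ (crossCov ℂ D) ^ i)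
          (dblCopy ℂ 0 (ExteriorAlgebra.map (Matrix.toLin' M) a') * dblCopy ℂ 1 (ExteriorAlgebra.map (Matrix.toLin' M) b'))))) m X'‖ ≤
      R ^ m * ∑ s : Fin m → Fin 2, ∑ i ∈ S, ‖c i‖ * B s i := by
  rw [LinearMap.sum_apply, map_sum, map_sum, kernel_sum]
  refine (norm_sum_le _ _).trans ?_
  have hterm : ∀ i ∈ S, ‖kernel ℂ (dblFold ℂ (grassmannLaplacian ℂ (crossCov ℂ g)
      ((c i • grassmannLaplacian ℂ (crossCov ℂ D) ^ i)
        (dblCopy ℂ 0 (ExteriorAlgebra.map (Matrix.toLin' M) a') * dblCopy ℂ 1 (ExteriorAlgebra.map (Matrix.toLin' M) b'))))) m X'‖ ≤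
      ‖c i‖ * (R ^ m * ∑ s : Fin m → Fin 2, B s i) := by
    intro i hi
    rw [LinearMap.smul_apply, map_smul, map_smul, kernel_smul, norm_mul, dblFold_crossLaplacian_mul_pow_map]
    exact mul_le_mul_of_nonneg_left (norm_kernel_map_dblFold_le_of_rowSum _ _ m X'
      (fun a => by simpa only [LinearMap.toMatrix'_toLin'] using hrow a) (fun s => B s i) (fun s => hB0 s i) (hB i hi)) (norm_nonneg _)
  refine (sum_le_sum hterm).trans (le_of_eq ?_)
  rw [sum_comm, mul_sum]
  refine sum_congr rfl fun i _ => ?_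
  rw [mul_sum, mul_sum, mul_sum]
  refine sum_congr rfl fun s _ => ?_
  ring

/-- **The same with the sum restricted afterwards**: if the weights vanish off `S` inside a larger range, nothing changes — stated as the
monotonicity a consumer uses to pass from `Σ_{i<N+2}` (`gaussConv_eq_sum_range`) minus the excluded small orders to any `S`. [folklore] -/
theorem sum_smul_pow_eq_sum_filter {A : Type*} [AddCommMonoid A] [Module ℂ A] (T : ℕ → A) (c : ℕ → ℂ) (S : Finset ℕ) (p : ℕ → Prop)
    [DecidablePred p] (hc : ∀ i ∈ S, ¬ p i → c i = 0) :
    ∑ i ∈ S, c i • T i = ∑ i ∈ S.filter p, c i • T i := by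
  rw [sum_filter]
  refine sum_congr rfl fun i hi => ?_
  by_cases h : p i
  · rw [if_pos h]
  · rw [if_neg h, hc i hi h, zero_smul]

end Bound

end Summit.HubbardSuperconductivity.HubbardSuperconductivity.Theorems.KLRegimeWick

end
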